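import Summits.PneNP.PneNP.Theorems.ConvexRankGatesCaptureTJoinDefs
import Mathlib.Combinatorics.SimpleGraph.Paths
import Mathlib.Algebra.Order.BigOperators.Ring.Finset
import Mathlib.Tactic.Linarith
import Mathlib.Tactic.NormNum
import HarnessLib

/-!
# Crux `Capture` (stmt-PneNP-2659) — the T-JOIN door is ONE GRANK gate: lazy walks

Support and positivity of the lazy walk matrix `(1 + adjW p q w)^m` of the edge list `(p i, q i)`:

* `pow_apply_ne_zero_reachable` — if the weights of the UNselected edges vanish, a non-zero entry
  `((1 + A)^m) u u'` forces `u` and `u'` to be connected by selected edges (every surviving product of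
  entries is a lazy walk through selected edges);
* `pow_card_apply_pos_of_reachable` — with the indicator weights of the selected edges over `ℚ`, connected
  vertices have a POSITIVE entry in `(1 + A)^{|V|}` (a path has fewer than `|V|` edges, laziness pads it).

The selected subgraph is `SimpleGraph.fromRel (fun a b => ∃ i, v i = true ∧ p i = a ∧ q i = b)`.
These are the two halves of "the pairing matrix is supported on the connectivity classes of the
terminals, and positive inside them" used by `pairConnected_isGRankGate`. [folklore]
-/

namespace Summit.PneNP.PneNP.Theorems.Capture.TJoin

set_option linter.dupNamespace false -- `Summit.PneNP.PneNP.…`: summit = sub-problem (D-0017)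

open Matrix Finset

variable {V : Type} [Fintype V] [DecidableEq V] {n : ℕ}

/-! ### Support: non-zero walk weights force connectivity through selected edges -/

omit [Fintype V] in
/-- A non-zero entry of the weighted adjacency matrix with vanishing unselected weights is a selected
edge (or a loop). [folklore] -/
theorem adjW_apply_ne_zero {R : Type*} [CommRing R] (p q : Fin n → V) (v : Fin n → Bool) (w : Fin n → R)
    (hw : ∀ i, v i = false → w i = 0) {u u' : V} (h : adjW p q w u u' ≠ 0) :
    ∃ i, v i = true ∧ ((p i = u ∧ q i = u') ∨ (p i = u' ∧ q i = u)) := by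
  rw [adjW_apply] at h
  obtain ⟨i, -, hi⟩ := Finset.exists_ne_zero_of_sum_ne_zero h
  refine ⟨i, ?_, ?_⟩
  · by_contra hv
    have hv' : v i = false := by simpa using hv
    apply hi
    split_ifs
    · exact hw i hv'
    · rfl
  · by_contra hpq
    exact hi (if_neg hpq)

/-- **Support of lazy walks**: if the unselected edge weights vanish and `((1 + adjW)^m) u u' ≠ 0`, then `u`
and `u'` are connected in the selected subgraph. [folklore] -/
theorem pow_apply_ne_zero_reachable {R : Type*} [CommRing R] (p q : Fin n → V) (v : Fin n → Bool)
    (w : Fin n → R) (hw : ∀ i, v i = false → w i = 0) :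
    ∀ (m : ℕ) (u u' : V), ((1 + adjW p q w) ^ m) u u' ≠ 0 →
      (SimpleGraph.fromRel fun a b => ∃ i, v i = true ∧ p i = a ∧ q i = b).Reachable u u' := by
  intro m
  induction m with
  | zero =>
      intro u u' h
      rw [pow_zero, Matrix.one_apply] at h
      by_cases huu : u = u'
      · subst huu
        exact SimpleGraph.Reachable.refl _
      · exact absurd (if_neg huu) h
  | succ m ih =>
      intro u u' h
      rw [pow_succ, Matrix.mul_apply] at h
      obtain ⟨z, -, hz⟩ := Finset.exists_ne_zero_of_sum_ne_zero h
      have h1 : ((1 + adjW p q w) ^ m) u z ≠ 0 := fun h0 => hz (by rw [h0, zero_mul])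
      have h2 : (1 + adjW p q w) z u' ≠ 0 := fun h0 => hz (by rw [h0, mul_zero])
      refine (ih u z h1).trans ?_
      by_cases hzu : z = u'
      · subst hzu
        exact SimpleGraph.Reachable.refl _
      · have hadj : adjW p q w z u' ≠ 0 := by
          rw [Matrix.add_apply, Matrix.one_apply, if_neg hzu, zero_add] at h2
          exact h2
        obtain ⟨i, hvi, hi⟩ := adjW_apply_ne_zero p q v w hw hadj
        refine SimpleGraph.Adj.reachable ?_
        rw [SimpleGraph.fromRel_adj]
        refine ⟨hzu, ?_⟩
        rcases hi with ⟨h3, h4⟩ | ⟨h3, h4⟩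
        · exact Or.inl ⟨i, hvi, h3, h4⟩
        · exact Or.inr ⟨i, hvi, h3, h4⟩

/-! ### Positivity: indicator weights over `ℚ` -/

omit [Fintype V] in
/-- Entries of the indicator-weighted adjacency matrix are non-negative. [folklore] -/
theorem adjW_indicator_nonneg (p q : Fin n → V) (v : Fin n → Bool) (u u' : V) :
    0 ≤ adjW p q (fun i => if v i then (1 : ℚ) else 0) u u' := by
  rw [adjW_apply]
  refine Finset.sum_nonneg fun i _ => ?_
  split_ifs <;> norm_num

omit [Fintype V] in
/-- Entries of `1 + A` are non-negative and the diagonal is at least `1` (laziness). [folklore] -/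
theorem step_indicator_nonneg (p q : Fin n → V) (v : Fin n → Bool) (u u' : V) :
    0 ≤ (1 + adjW p q (fun i => if v i then (1 : ℚ) else 0)) u u' := by
  rw [Matrix.add_apply, Matrix.one_apply]
  have h := adjW_indicator_nonneg p q v u u'
  split_ifs <;> linarith

omit [Fintype V] in
/-- The diagonal of `1 + A` is at least `1`. [folklore] -/
theorem one_le_step_indicator_diag (p q : Fin n → V) (v : Fin n → Bool) (u : V) :
    1 ≤ (1 + adjW p q (fun i => if v i then (1 : ℚ) else 0)) u u := by
  rw [Matrix.add_apply, Matrix.one_apply_eq]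
  have h := adjW_indicator_nonneg p q v u u
  linarith

omit [Fintype V] in
/-- A selected edge gives an entry `≥ 1` of `1 + A`. [folklore] -/
theorem one_le_step_indicator_of_adj (p q : Fin n → V) (v : Fin n → Bool) {u u' : V}
    (h : (SimpleGraph.fromRel fun a b => ∃ i, v i = true ∧ p i = a ∧ q i = b).Adj u u') :
    1 ≤ (1 + adjW p q (fun i => if v i then (1 : ℚ) else 0)) u u' := by
  rw [SimpleGraph.fromRel_adj] at h
  obtain ⟨-, h⟩ := h
  have hex : ∃ i, v i = true ∧ ((p i = u ∧ q i = u') ∨ (p i = u' ∧ q i = u)) := by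
    rcases h with ⟨i, hvi, h1, h2⟩ | ⟨i, hvi, h1, h2⟩
    · exact ⟨i, hvi, Or.inl ⟨h1, h2⟩⟩
    · exact ⟨i, hvi, Or.inr ⟨h1, h2⟩⟩
  obtain ⟨i, hvi, hi⟩ := hex
  have hA : 1 ≤ adjW p q (fun i => if v i then (1 : ℚ) else 0) u u' := by
    rw [adjW_apply]
    calc (1 : ℚ) = (if (p i = u ∧ q i = u') ∨ (p i = u' ∧ q i = u) then
          (if v i then (1 : ℚ) else 0) else 0) := by rw [if_pos hi, if_pos hvi]
      _ ≤ ∑ i', (if (p i' = u ∧ q i' = u') ∨ (p i' = u' ∧ q i' = u) then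
          (if v i' then (1 : ℚ) else 0) else 0) :=
        Finset.single_le_sum (f := fun i' => if (p i' = u ∧ q i' = u') ∨ (p i' = u' ∧ q i' = u) then
            (if v i' then (1 : ℚ) else 0) else 0) (fun i' _ => by split_ifs <;> norm_num)
          (Finset.mem_univ i)
  rw [Matrix.add_apply, Matrix.one_apply]
  split_ifs <;> linarith

/-- Powers of `1 + A` (indicator weights) have non-negative entries. [folklore] -/
theorem pow_indicator_nonneg (p q : Fin n → V) (v : Fin n → Bool) :
    ∀ (m : ℕ) (u u' : V), 0 ≤ ((1 + adjW p q (fun i => if v i then (1 : ℚ) else 0)) ^ m) u u' := by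
  intro m
  induction m with
  | zero =>
      intro u u'
      rw [pow_zero, Matrix.one_apply]
      split_ifs <;> norm_num
  | succ m ih =>
      intro u u'
      rw [pow_succ, Matrix.mul_apply]
      exact Finset.sum_nonneg fun z _ => mul_nonneg (ih u z) (step_indicator_nonneg p q v z u')

/-- One more lazy step does not decrease an entry: `((1+A)^m) u u' ≤ ((1+A)^(m+1)) u u'`. [folklore] -/
theorem pow_indicator_apply_le_succ (p q : Fin n → V) (v : Fin n → Bool) (m : ℕ) (u u' : V) :
    ((1 + adjW p q (fun i => if v i then (1 : ℚ) else 0)) ^ m) u u' ≤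
      ((1 + adjW p q (fun i => if v i then (1 : ℚ) else 0)) ^ (m + 1)) u u' := by
  rw [pow_succ, Matrix.mul_apply]
  calc ((1 + adjW p q (fun i => if v i then (1 : ℚ) else 0)) ^ m) u u'
      ≤ ((1 + adjW p q (fun i => if v i then (1 : ℚ) else 0)) ^ m) u u' *
          (1 + adjW p q (fun i => if v i then (1 : ℚ) else 0)) u' u' :=
        le_mul_of_one_le_right (pow_indicator_nonneg p q v m u u') (one_le_step_indicator_diag p q v u')
    _ ≤ _ := Finset.single_le_sum (f := fun z => ((1 + adjW p q (fun i => if v i then (1 : ℚ) else 0)) ^ m) u z *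
          (1 + adjW p q (fun i => if v i then (1 : ℚ) else 0)) z u')
        (fun z _ => mul_nonneg (pow_indicator_nonneg p q v m u z) (step_indicator_nonneg p q v z u'))
        (Finset.mem_univ u')

/-- Monotonicity in the exponent. [folklore] -/
theorem pow_indicator_apply_mono (p q : Fin n → V) (v : Fin n → Bool) {m m' : ℕ} (h : m ≤ m') (u u' : V) :
    ((1 + adjW p q (fun i => if v i then (1 : ℚ) else 0)) ^ m) u u' ≤
      ((1 + adjW p q (fun i => if v i then (1 : ℚ) else 0)) ^ m') u u' := by
  induction h with
  | refl => exact le_rfl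
  | step _ ih => exact ih.trans (pow_indicator_apply_le_succ p q v _ u u')

/-- **A walk of length `r` in the selected subgraph gives an entry `≥ 1` of `(1 + A)^r`.** [folklore] -/
theorem one_le_pow_indicator_of_walk (p q : Fin n → V) (v : Fin n → Bool) :
    ∀ {u u' : V} (W : (SimpleGraph.fromRel fun a b => ∃ i, v i = true ∧ p i = a ∧ q i = b).Walk u u'),
      1 ≤ ((1 + adjW p q (fun i => if v i then (1 : ℚ) else 0)) ^ W.length) u u' := by
  intro u u' W
  induction W with
  | nil => simp
  | @cons a b c hadj W ih =>
      rw [SimpleGraph.Walk.length_cons, pow_succ', Matrix.mul_apply]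
      calc (1 : ℚ) ≤ (1 + adjW p q (fun i => if v i then (1 : ℚ) else 0)) a b *
            ((1 + adjW p q (fun i => if v i then (1 : ℚ) else 0)) ^ W.length) b c := by
            have h1 := one_le_step_indicator_of_adj p q v hadj
            have h2 := ih
            nlinarith
        _ ≤ _ := Finset.single_le_sum (f := fun z => (1 + adjW p q (fun i => if v i then (1 : ℚ) else 0)) a z *
            ((1 + adjW p q (fun i => if v i then (1 : ℚ) else 0)) ^ W.length) z c)
          (fun z _ => mul_nonneg (step_indicator_nonneg p q v a z) (pow_indicator_nonneg p q v _ z c))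
          (Finset.mem_univ b)

/-- **Positivity of lazy walks**: connected vertices of the selected subgraph have a positive entry in
`(1 + A)^{|V|}` (indicator weights): a path has fewer than `|V|` edges and laziness pads it. [folklore] -/
theorem pow_card_apply_pos_of_reachable : ∀ {V : Type} [Fintype V] [DecidableEq V] {n : ℕ}
    (p q : Fin n → V) (v : Fin n → Bool) {u u' : V},
    (SimpleGraph.fromRel fun a b => ∃ i, v i = true ∧ p i = a ∧ q i = b).Reachable u u' →
    0 < ((1 + adjW p q (fun i => if v i then (1 : ℚ) else 0)) ^ Fintype.card V) u u' := by
  intro V _ _ n p q v u u' h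
  refine h.elim_path fun P => ?_
  have hlen : P.1.length ≤ Fintype.card V := (SimpleGraph.Walk.IsPath.length_lt P.2).le
  have h1 := one_le_pow_indicator_of_walk p q v P.1
  have h2 := pow_indicator_apply_mono p q v hlen u u'
  linarith

end Summit.PneNP.PneNP.Theorems.Capture.TJoin
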